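import Summits.SmoothPoincare4.SmoothPoincare4.Theorems.DottedCircleRasmussenDcrGapHelperHandlebodyChartModelHandlesCollarAux
import Summits.SmoothPoincare4.SmoothPoincare4.Theorems.DottedCircleRasmussenDcrGapHelperHandlebodyChartModelHandlesRadial

/-!
# Helper `helper_handlebodyChart_modelHandles` (M3: handle structure of the model dotted handlebody `D_k`)
# of line `mk_friends` for crux `DcrGap` — the radial squeeze of the `w`-fibres
(item stmt-SmoothPoincare4-16128, route route-SmoothPoincare4-DottedCircleRasmussen)

**Registered piece `helper_handlebodyChart_modelHandles_fibreSqueeze` of the model lemma M3.**  Second stage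
of the squeeze of part 2 of the data stub `helper_handlebodyChart_modelHandles_data` (after the collar push
of `…ModelHandlesCollarPhase`, which carries `D_k` into `D_k ∩ {G_k ≤ 24/25}`): for every `δ > 0` a
diffeomorphism `κ` of `ℝ⁴ = ℂ²`, the identity off a compact subset of `D_k`, commuting with the rotations
`(z, w) ↦ (z, u w)` of the `w`-plane, of the form `(z, w) ↦ (z, (1 + b) w)` — so it does not move the planar
shadow `z` (its swept angles vanish), does not increase `|w|`, the hole terms, or `G_k` — and squeezing the
fibres over the compact part: `|w(κ x)| ≤ δ` for `x ∈ D_k ∩ {G_k ≤ 24/25}`.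

Proof (`ModelHandles.exists_fibre_squeeze`): `κ` is the radial push `x ↦ x + b(x) P x` of
`…ModelHandlesRadial` (`ModelHandles.exists_radial_diffeomorph`) along the projection `P` onto the
`w`-plane, with amplitude `b = (μ - 1) φ(G_k)` cut off to the half-guard zone (`μ = min δ 1`, `φ = 1` below
`24/25`, `φ = 0` above `97/100`, `φ` non-increasing).  The criterion `1 + b + Db[P x] > 0` of that file holds
because `Db[P x] = (μ - 1) φ'(G_k) · 2|w|² ≥ 0` (`φ' ≤ 0`) and `1 + b ≥ μ`; equivariance because `b` is
invariant and `P` commutes with the rotations.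

No definitions, no named facts, no `sorry`.  References: M. W. Hirsch, *Differential Topology* (1976),
Ch. 8 §1 (radial isotopies) [HirschDT1976].
-/

-- the prescribed namespace `Summit.<P>.<Sub>.…` duplicates `SmoothPoincare4` (P = Sub)
set_option linter.dupNamespace false
set_option linter.style.longLine false
noncomputable section

open scoped Manifold ContDiff Topology
open Function Set Metric Filter
open Literature.Topology.FourManifolds Literature.Topology.FourManifolds.MMSW
open Literature.AlgebraicTopology.Homotopy.HopfFibration

namespace Summit.SmoothPoincare4.SmoothPoincare4.Theorems.DcrGap.MkFriends

namespace ModelHandles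

/-- The projection `(z, w) ↦ (0, w)` onto the `w`-plane is a continuous linear map of `ℝ⁴`. [folklore] -/
theorem exists_clm_wProj : ∃ P : EuclideanSpace ℝ (Fin 4) →L[ℝ] EuclideanSpace ℝ (Fin 4),
    ∀ y, P y = ofZW 0 (wC y) := by
  refine ⟨LinearMap.toContinuousLinearMap
    { toFun := fun y => ofZW 0 (wC y)
      map_add' := fun y y' => ?_
      map_smul' := fun c y => ?_ }, fun y => rfl⟩
  · ext i
    fin_cases i <;> simp [ofZW, wC]
  · ext i
    fin_cases i <;> simp [ofZW, wC]

/-- Coordinates of the radial push along the `w`-plane: `z` is fixed and `w` is scaled by `1 + t`.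
[folklore] -/
theorem zC_wC_add_smul_wProj (x : EuclideanSpace ℝ (Fin 4)) (t : ℝ) :
    zC (x + t • ofZW 0 (wC x)) = zC x ∧ wC (x + t • ofZW 0 (wC x)) = (1 + t) * wC x := by
  constructor
  · apply Complex.ext <;> simp [zC, ofZW]
  · apply Complex.ext <;> simp [wC, ofZW] <;> ring

/-- `|w|² ≤ G_k` off the poles, hence `|w| ≤ 1` on `D_k`. [folklore] -/
theorem norm_wC_sq_le_levelFun {k : ℕ} {y : EuclideanSpace ℝ (Fin 4)} (hy : ∀ j, 0 < holeTerm k j y) :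
    ‖wC y‖ ^ 2 ≤ levelFun k y := by
  have h := (FriendsH2.levelFun_bounds hy).2.1
  have hw : ‖wC y‖ ^ 2 = (y 2) ^ 2 + (y 3) ^ 2 := by
    rw [Complex.sq_norm, Complex.normSq_apply]; simp [wC, sq]
  rw [hw]; exact h

/-- **The radial squeeze of the `w`-fibres** (see the module docstring): for `δ > 0` a diffeomorphism of
`ℝ⁴` of the form `(z, w) ↦ (z, (1 + b) w)`, `μ - 1 ≤ b ≤ 0` (`μ = min δ 1`), the identity off a compact subset
of `D_k`, commuting with the rotations of the `w`-plane, fixing `z`, not increasing `|w|`, the hole terms or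
`G_k`, with `|w(κ x)| ≤ δ` on `D_k ∩ {G_k ≤ 24/25}`. [folklore] -/
theorem exists_fibre_squeeze (k : ℕ) {δ : ℝ} (hδ : 0 < δ) :
    ∃ (κ : EuclideanSpace ℝ (Fin 4) ≃ₘ⟮𝓡 4, 𝓡 4⟯ EuclideanSpace ℝ (Fin 4)) (K : Set (EuclideanSpace ℝ (Fin 4))),
      IsCompact K ∧ K ⊆ modelHandlebody k ∧ (∀ x, x ∉ K → κ x = x) ∧
      (∀ v : ℂ, ‖v‖ = 1 → ∀ x, κ (fibreRot (fun _ => v) x) = fibreRot (fun _ => v) (κ x)) ∧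
      (∀ x, zC (κ x) = zC x) ∧ (∀ x, ‖wC (κ x)‖ ≤ ‖wC x‖) ∧ (∀ x j, holeTerm k j (κ x) = holeTerm k j x) ∧
      (∀ x, levelFun k (κ x) ≤ levelFun k x) ∧
      ∀ x ∈ modelHandlebody k, levelFun k x ≤ 24 / 25 → ‖wC (κ x)‖ ≤ δ := by
  -- constants and cutoff
  set μ : ℝ := min δ 1 with hμ
  have hμ0 : 0 < μ := lt_min hδ one_pos
  have hμ1 : μ ≤ 1 := min_le_right _ _
  have hμδ : μ ≤ δ := min_le_left _ _
  set φ : ℝ → ℝ := fun g => Real.smoothTransition (100 * (97 / 100 - g)) with hφ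
  have hφs : ContDiff ℝ ∞ φ :=
    Real.smoothTransition.contDiff.comp (contDiff_const.mul (contDiff_const.sub contDiff_id))
  have hφ1 : ∀ g, g ≤ 24 / 25 → φ g = 1 := fun g hg =>
    Real.smoothTransition.one_of_one_le (by linarith)
  have hφ0 : ∀ g, φ g ≠ 0 → g < 97 / 100 := fun g hg => by
    by_contra hle; push Not at hle
    exact hg (Real.smoothTransition.zero_of_nonpos (by linarith))
  have hφle : ∀ g, φ g ≤ 1 := fun g => Real.smoothTransition.le_one _
  have hφanti : Antitone φ := fun g g' hgg' =>
    Real.smoothTransition.monotone (by linarith)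
  have hφ' : ∀ g, deriv φ g ≤ 0 := fun g => hφanti.deriv_nonpos
  set χ : EuclideanSpace ℝ (Fin 4) → ℝ :=
    fun y => if ∀ j : Fin k, (1 : ℝ) / 4 < holeTerm k j y then φ (levelFun k y) else 0 with hχ
  set b : EuclideanSpace ℝ (Fin 4) → ℝ := fun y => (μ - 1) * χ y with hb
  have hpos4 : ∀ y : EuclideanSpace ℝ (Fin 4), (∀ j, (1 : ℝ) / 4 < holeTerm k j y) →
      ∀ j, 0 < holeTerm k j y := fun y h j => lt_trans (by norm_num) (h j)
  have hχne : ∀ y, χ y ≠ 0 → (∀ j, (1 : ℝ) / 4 < holeTerm k j y) ∧ levelFun k y < 97 / 100 := by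
    intro y h
    simp only [hχ] at h
    split_ifs at h with h4
    · exact ⟨h4, hφ0 _ h⟩
    · exact absurd rfl h
  have hχ01 : ∀ y, 0 ≤ χ y ∧ χ y ≤ 1 := by
    intro y
    simp only [hχ]
    split_ifs
    · exact ⟨Real.smoothTransition.nonneg _, hφle _⟩
    · exact ⟨le_rfl, zero_le_one⟩
  have hb01 : ∀ y, μ - 1 ≤ b y ∧ b y ≤ 0 := fun y => by
    constructor <;> simp only [hb] <;> nlinarith [(hχ01 y).1, (hχ01 y).2, hμ1]
  -- the support set
  set K : Set (EuclideanSpace ℝ (Fin 4)) := {y | (∀ j : Fin k, (1 : ℝ) ≤ holeTerm k j y) ∧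
    levelFun k y ≤ 97 / 100} with hK
  have hKD : K ⊆ modelHandlebody k := fun y hy => ⟨hy.1, by linarith [hy.2]⟩
  have hbK : ∀ y, b y ≠ 0 → y ∈ K := by
    intro y hy
    have hχy : χ y ≠ 0 := fun h0 => hy (by simp only [hb, h0, mul_zero])
    obtain ⟨h4, hG⟩ := hχne y hχy
    refine ⟨fun j => ?_, hG.le⟩
    have h := ((FriendsH2.levelFun_bounds (hpos4 y h4)).2.2 j).trans hG.le
    rw [div_le_iff₀ (hpos4 y h4 j)] at h
    nlinarith [hpos4 y h4 j]
  have hKc : IsCompact K := by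
    have hKeq : K = {y : EuclideanSpace ℝ (Fin 4) | ∀ j : Fin k, (1 : ℝ) ≤ holeTerm k j y} ∩
        levelFun k ⁻¹' Iic (97 / 100) := rfl
    refine Metric.isCompact_of_isClosed_isBounded ?_ ?_
    · rw [hKeq]
      exact (continuousOn_levelFun (by norm_num : (0 : ℝ) < 1)).preimage_isClosed_of_isClosed
        (isClosed_guard 1) isClosed_Iic
    · refine (isBounded_closedBall (x := (0 : EuclideanSpace ℝ (Fin 4)))
        (r := 40 * ((k : ℝ) + 1) + 1)).subset fun y hy => mem_closedBall_zero_iff.2 ?_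
      have hpos : ∀ j, 0 < holeTerm k j y := fun j => lt_of_lt_of_le (by norm_num) (hy.1 j)
      have h1 := FriendsH2.norm_sq_le_levelFun hpos
      have h5 : ‖y‖ ^ 2 ≤ (40 * ((k : ℝ) + 1) + 1) ^ 2 := by
        have h2 : levelFun k y * ((40 * ((k : ℝ) + 1)) ^ 2 + 1) ≤ 1 * ((40 * ((k : ℝ) + 1)) ^ 2 + 1) :=
          mul_le_mul_of_nonneg_right (by linarith [hy.2]) (by positivity)
        have hk : (0 : ℝ) ≤ k := k.cast_nonneg
        nlinarith
      exact le_of_pow_le_pow_left₀ two_ne_zero (by positivity) h5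
  -- smoothness of `b`
  have hχs : ContDiff ℝ ∞ χ := by
    rw [contDiff_iff_contDiffAt]
    intro y
    by_cases hy4 : ∀ j : Fin k, (1 : ℝ) / 4 < holeTerm k j y
    · have hy0 : ∀ j, holeTerm k j y ≠ 0 := fun j => (hpos4 y hy4 j).ne'
      have hev : χ =ᶠ[𝓝 y] fun y' => φ (levelFun k y') := by
        filter_upwards [(isOpen_guard (1 / 4)).mem_nhds hy4] with y' hy'
        simp only [hχ, if_pos hy']
      exact (hφs.contDiffAt.comp y (contDiffAt_levelFun hy0)).congr_of_eventuallyEq hev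
    · push Not at hy4
      obtain ⟨j, hj⟩ := hy4
      have hev : χ =ᶠ[𝓝 y] fun _ => 0 := by
        have hopen : IsOpen {y' : EuclideanSpace ℝ (Fin 4) | holeTerm k j y' < 1 / 2} :=
          isOpen_lt (continuous_holeTerm j) continuous_const
        filter_upwards [hopen.mem_nhds (show holeTerm k j y < 1 / 2 by linarith)] with y' hy'
        by_contra h
        obtain ⟨h4, hG⟩ := hχne y' h
        have := FriendsH2.half_lt_holeTerm_of_levelFun_lt_two (hpos4 y' h4) (by linarith) j
        linarith
      exact (contDiffAt_const (c := (0 : ℝ))).congr_of_eventuallyEq hev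
  have hbs : ContDiff ℝ ∞ b := contDiff_const.mul hχs
  -- `b` vanishes far out
  have hR : ∃ R : ℝ, ∀ x, R ≤ ‖x‖ → b x = 0 := by
    refine ⟨40 * ((k : ℝ) + 1) + 2, fun x hx => ?_⟩
    by_contra hbx
    have hxK := hbK x hbx
    have hpos : ∀ j, 0 < holeTerm k j x := fun j => lt_of_lt_of_le (by norm_num) (hxK.1 j)
    have h1 := FriendsH2.norm_sq_le_levelFun hpos
    have h2 : levelFun k x * ((40 * ((k : ℝ) + 1)) ^ 2 + 1) ≤ 1 * ((40 * ((k : ℝ) + 1)) ^ 2 + 1) :=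
      mul_le_mul_of_nonneg_right (by linarith [hxK.2]) (by positivity)
    have hk : (0 : ℝ) ≤ k := k.cast_nonneg
    nlinarith [norm_nonneg x]
  -- the projection
  obtain ⟨P, hP⟩ := exists_clm_wProj
  have hPP : ∀ x, P (P x) = P x := fun x => by rw [hP, hP, wC_ofZW]
  have hP0 : ∀ x, (P x) 0 = 0 := fun x => by rw [hP]; simp [ofZW]
  have hP1 : ∀ x, (P x) 1 = 0 := fun x => by rw [hP]; simp [ofZW]
  have hP2 : ∀ x, (P x) 2 = x 2 := fun x => by rw [hP]; simp [ofZW, wC]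
  have hP3 : ∀ x, (P x) 3 = x 3 := fun x => by rw [hP]; simp [ofZW, wC]
  -- the monotonicity criterion
  have hcrit : ∀ x, 0 < 1 + b x + fderiv ℝ b x (P (x - 0)) := by
    intro x
    rw [sub_zero]
    by_cases hx4 : ∀ j : Fin k, (1 : ℝ) / 4 < holeTerm k j x
    · have hx0 : ∀ j, holeTerm k j x ≠ 0 := fun j => (hpos4 x hx4 j).ne'
      have hev : b =ᶠ[𝓝 x] fun y => (μ - 1) * φ (levelFun k y) := by
        filter_upwards [(isOpen_guard (1 / 4)).mem_nhds hx4] with y hy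
        simp only [hb, hχ, if_pos hy]
      have hGd : HasFDerivAt (levelFun k) (fderiv ℝ (levelFun k) x) x :=
        ((contDiffAt_levelFun hx0).differentiableAt (by simp)).hasFDerivAt
      have hφd : HasDerivAt φ (deriv φ (levelFun k x)) (levelFun k x) :=
        (hφs.differentiable (by simp) _).hasDerivAt
      have hcomp : HasFDerivAt (fun y => (μ - 1) * φ (levelFun k y))
          ((μ - 1) • (deriv φ (levelFun k x) • fderiv ℝ (levelFun k) x)) x :=
        (hφd.comp_hasFDerivAt x hGd).const_mul (μ - 1)
      rw [hev.fderiv_eq, hcomp.fderiv]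
      have hval : fderiv ℝ (levelFun k) x (P x) = 2 * ((x 2) ^ 2 + (x 3) ^ 2) := by
        rw [fderiv_levelFun_apply hx0, hP0, hP1, hP2, hP3]; ring
      simp only [FunLike.coe_smul, Pi.smul_apply, smul_eq_mul, hval]
      have hbx : b x = (μ - 1) * φ (levelFun k x) := hev.self_of_nhds
      rw [hbx]
      have h3 : 0 ≤ (μ - 1) * (deriv φ (levelFun k x) * (2 * ((x 2) ^ 2 + (x 3) ^ 2))) := by
        apply mul_nonneg_of_nonpos_of_nonpos (by linarith)
        exact mul_nonpos_of_nonpos_of_nonneg (hφ' _) (by positivity)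
      nlinarith [hφle (levelFun k x)]
    · push Not at hx4
      obtain ⟨j, hj⟩ := hx4
      have hev : b =ᶠ[𝓝 x] fun _ => 0 := by
        have hopen : IsOpen {y' : EuclideanSpace ℝ (Fin 4) | holeTerm k j y' < 1 / 2} :=
          isOpen_lt (continuous_holeTerm j) continuous_const
        filter_upwards [hopen.mem_nhds (show holeTerm k j x < 1 / 2 by linarith)] with y' hy'
        by_contra h
        have := (hbK y' h).1 j
        linarith
      rw [hev.fderiv_eq, hev.self_of_nhds]
      simp
  -- the diffeomorphism
  obtain ⟨Φ, hΦ⟩ := exists_radial_diffeomorph P hPP 0 hbs hR hcrit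
  have hΦ' : ∀ x, Φ x = x + b x • ofZW 0 (wC x) := fun x => by rw [hΦ, sub_zero, hP]
  have hzΦ : ∀ x, zC (Φ x) = zC x := fun x => by rw [hΦ']; exact (zC_wC_add_smul_wProj x (b x)).1
  have hwΦ : ∀ x, wC (Φ x) = (1 + b x) * wC x := fun x => by rw [hΦ']; exact (zC_wC_add_smul_wProj x (b x)).2
  have hnorm : ∀ x, ‖wC (Φ x)‖ = (1 + b x) * ‖wC x‖ := fun x => by
    rw [hwΦ, norm_mul]
    have : ‖(1 : ℂ) + (b x : ℂ)‖ = 1 + b x := by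
      rw [show (1 : ℂ) + (b x : ℂ) = ((1 + b x : ℝ) : ℂ) by push_cast; ring, Complex.norm_real,
        Real.norm_eq_abs, abs_of_pos (by linarith [(hb01 x).1])]
    rw [this]
  have hT : ∀ x j, holeTerm k j (Φ x) = holeTerm k j x := fun x j => by
    rw [holeTerm_eq_normSq, holeTerm_eq_normSq, hzΦ]
  refine ⟨Φ, K, hKc, hKD, fun x hx => ?_, fun v hv x => ?_, hzΦ, fun x => ?_, hT, fun x => ?_,
    fun x hx hG => ?_⟩
  · have hb0 : b x = 0 := by by_contra h; exact hx (hbK x h)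
    rw [hΦ', hb0, zero_smul, add_zero]
  · obtain ⟨L, hL⟩ := exists_clm_fibreRot_const v
    have hbinv : b (fibreRot (fun _ => v) x) = b x := by
      have hTr : ∀ j, holeTerm k j (fibreRot (fun _ => v) x) = holeTerm k j x := fun j =>
        holeTerm_fibreRot _ j x
      have hGr : levelFun k (fibreRot (fun _ => v) x) = levelFun k x := levelFun_fibreRot (by simpa using hv)
      simp only [hb, hχ, hTr, hGr]
    have hProt : ofZW 0 (wC (fibreRot (fun _ => v) x)) = fibreRot (fun _ => v) (ofZW 0 (wC x)) := by
      simp [fibreRot]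
    rw [hΦ', hΦ', hbinv, hProt, ← hL, ← hL, ← hL, map_add, map_smul]
  · rw [hnorm]
    have := (hb01 x).2
    nlinarith [norm_nonneg (wC x)]
  · have h1 := levelFun_sub_normSq_w (r := k) (Φ x)
    have h2 := levelFun_sub_normSq_w (r := k) x
    rw [hzΦ] at h1
    have hw : ∀ y : EuclideanSpace ℝ (Fin 4), (y 2) ^ 2 + (y 3) ^ 2 = ‖wC y‖ ^ 2 := fun y => by
      rw [Complex.sq_norm, Complex.normSq_apply]; simp [wC, sq]
    rw [hw] at h1 h2
    have h3 : ‖wC (Φ x)‖ ^ 2 ≤ ‖wC x‖ ^ 2 := by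
      rw [hnorm, mul_pow]
      refine mul_le_of_le_one_left (sq_nonneg _) ?_
      exact pow_le_one₀ (by linarith [(hb01 x).1]) (by linarith [(hb01 x).2])
    linarith
  · have hx4 : ∀ j : Fin k, (1 : ℝ) / 4 < holeTerm k j x := fun j => by linarith [hx.1 j]
    have hbx : b x = μ - 1 := by simp only [hb, hχ, if_pos hx4, hφ1 _ hG, mul_one]
    rw [hnorm, hbx]
    have hw1 : ‖wC x‖ ≤ 1 := by
      have h := norm_wC_sq_le_levelFun (k := k) (fun j => lt_of_lt_of_le one_pos (hx.1 j))
      nlinarith [norm_nonneg (wC x), hx.2]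
    nlinarith [norm_nonneg (wC x)]

end ModelHandles

/-- **Registered piece `helper_handlebodyChart_modelHandles_fibreSqueeze` of the model lemma M3 (the radial
squeeze of the `w`-fibres)**: for `δ > 0` a diffeomorphism of `ℝ⁴`, the identity off a compact subset of `D_k`,
commuting with the rotations of the `w`-plane, fixing `z`, not increasing `|w|`, the hole terms or `G_k`, with
`|w(κ x)| ≤ δ` on `D_k ∩ {G_k ≤ 24/25}` (`ModelHandles.exists_fibre_squeeze`). [folklore] -/
theorem helper_handlebodyChart_modelHandles_fibreSqueeze : ∀ (k : ℕ) (δ : ℝ), 0 < δ → ∃ (κ : EuclideanSpace ℝ (Fin 4) ≃ₘ⟮𝓡 4, 𝓡 4⟯ EuclideanSpace ℝ (Fin 4)) (K : Set (EuclideanSpace ℝ (Fin 4))), IsCompact K ∧ K ⊆ Literature.Topology.FourManifolds.MMSW.modelHandlebody k ∧ (∀ x, x ∉ K → κ x = x) ∧ (∀ v : ℂ, ‖v‖ = 1 → ∀ x, κ (Literature.Topology.FourManifolds.MMSW.fibreRot (fun _ => v) x) = Literature.Topology.FourManifolds.MMSW.fibreRot (fun _ => v) (κ x)) ∧ (∀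 x, Literature.AlgebraicTopology.Homotopy.HopfFibration.zC (κ x) = Literature.AlgebraicTopology.Homotopy.HopfFibration.zC x) ∧ (∀ x, ‖Literature.AlgebraicTopology.Homotopy.HopfFibration.wC (κ x)‖ ≤ ‖Literature.AlgebraicTopology.Homotopy.HopfFibration.wC x‖) ∧ (∀ x j, Literature.Topology.FourManifolds.MMSW.holeTerm k j (κ x) = Literature.Topology.FourManifolds.MMSW.holeTerm k j x) ∧ (∀ x, Literature.Topology.FourManifolds.MMSW.levelFun k (κ x) ≤ Literature.Topology.FourManifolds.MMSW.levelFun k x) ∧ ∀ x ∈ Literature.Topology.FourManifolds.MMSW.modelHandlebody k, Literature.Topology.FourManifolds.MMSW.levelFun k x ≤ 24 / 25 → ‖Literature.AlgebraicTopology.Homotopy.HopfFibration.wC (κ x)‖ ≤ δ :=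
  fun k _ hδ => ModelHandles.exists_fibre_squeeze k hδ

end Summit.SmoothPoincare4.SmoothPoincare4.Theorems.DcrGap.MkFriends

end
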